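import Summits.QuantumFields.YangMills.Theorems.UnitScaleTiltProp7NestedMeanParallelLift
import HarnessLib

/-!
# Route `UnitScaleTilt`, crux «MinimiserStabilityRegPr» (stmt-QuantumFields-19200, stub EX), node N06(d = 3) — **THE RESIDUAL GAUGE ALGEBRA `N_S(U₀)` CHARACTERISED AT A
# PRINTED-REGULAR BACKGROUND: `toL2S λ ∈ N_S(U₀)` IFF THE TOP NESTED COVARIANT MEAN `ns_{K−n} λ` IS `Ū₀`-PARALLEL** — the converse of ★px20 g2 ✓`Prop7NestedMeanParallelLift.topMean_parallel_of_mem_NS`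
# ([Balaban1985BackgroundPropagators] (3.19)∕(3.114)–(3.115): `Q(U₀)(D_{U₀}λ) = D_{Ū₀}(Q′λ)`, so `ker(Q∘D) = {λ : Q′λ is Ū₀-parallel}`); in particular `Q′λ = 0 ⇒ λ ∈ N_S(U₀)` —
# print's `N(Q′) ⊆ N_S`, the hypothesis `hker`∕`hint` of ✓`Prop7PosMonotoneInProjector` §4 in the letters of the averaging of record

Cell `ym3-torus` (HUMAN RULING D-0037; rung R3 — NOT d = 4, NOT Clay; YM gap NOT proved).  Fleet lead seat `ym-ust-19200-p1` (gen 21).  THEOREMS ONLY (0 `def`, 0 `sorry`);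
`--supports stmt-QuantumFields-19200 --as helper`; count-neutral.  INGREDIENTS (all landed): ✓`Prop7SymAvgTwSGaugeDir.QTwS_gaugeDir_of_avgSeq` (w5), ✓`Prop7SymAvgTwSym.differentiableAt_logChartTwS_of_regPr`,
★px20 ✓`Prop7NestedMeanParallelLift.toL2_symm_DL2_toL2S_eq`∕`topMean_parallel_of_mem_NS`, bricks L0a∕L0c (`QL2`, `DL2`, `NS`).

WHAT IS PROVED (member `F`, `h : n ≤ K`, weights `c₀ > 0`, `cB`; `U₀ ∈ RegPr F n K ε₀`, window `10¹²L³ε₀ ≤ 1`; ns `…Theorems.Prop7NSOfParallelTopMean`).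
* ★★★ `mem_NS_of_topMean_parallel` — for ANY averaging sequence `ns` of `λ` (the `h0`∕`hsucc` recursion of ✓`QTwS_gaugeDir_of_avgSeq`), a `Ū₀`-PARALLEL top mean
  (`Ad_{Ū₀(e)} ns_{K−n}(e₊) = ns_{K−n}(e₋)` on every coarse bond) implies `toL2S λ ∈ N_S(U₀)`; ★★ `mem_NS_of_topMean_eq_zero` (`ns_{K−n} = 0` suffices — print's `N(Q′) ⊆ N_S`);
  ★★★ `mem_NS_iff_topMean_parallel` — the characterisation (with ★px20's direction).
WHY IT MATTERS (CARD-19200-V3-g21, NUMERICS-19200-RCORE-INTRINSIC-g21): the positivity∕coercivity rows of the EX face at the intrinsic letters are monotone in the projector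
(✓`Prop7PosMonotoneInProjector`), and the load-bearing structural fact is exactly `N(Q′) ⊆ N_S` for the averaging OF RECORD — this file proves it (for any parameter map whose kernel has
vanishing top nested mean), so print-letter suppliers of [B9] Thm 3.11 feed the face.
HONEST SCOPE.  Linear algebra over landed letters; no estimate; none of the 13 rows, `hThm2S`, EX or the crux is proved; nothing continuum ∕ OS ∕ mass-gap ∕ Clay.

References: T. Bałaban, CMP **99** (1985) 389–434 [Balaban1985BackgroundPropagators] ((3.3) p.391, (3.19)–(3.21) pp.393–394, (3.114)–(3.115) p.418); CMP **98** (1985) 17–51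
[Balaban1985Averaging] ((11) p.19, (97) p.32).
-/

set_option autoImplicit false

noncomputable section

open scoped BigOperators Matrix.Norms.L2Operator

namespace Summit.QuantumFields.YangMills.Theorems.Prop7NSOfParallelTopMean

open NormedSpace
open Literature.MathematicalPhysics.QuantumFieldTheory.Balaban1983to89
open Literature.MathematicalPhysics.QuantumFieldTheory.Balaban1983to89.T3ContinuumYM3Torus
open T4Continuum BlockAveraging ExpMeanLog MatrixLog
open BlockAveraging (Idx)
open B7Prop1Explicit (U1 mem_U1 treeWord disp)
open B7Eq78Linearization (conjR conjR_apply)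
open B10Eq27TorusAxialLog (holT transl)
open B7TransferAnalyticMean (meanCLM)
open B15DeterminingSets (embIter)
open Summit.QuantumFields.YangMills.Theorems.Prop8Chart (emlIterU)
open T3PrintedRegularMinimiser (RegPr)
open T3PrintedRegularOrbits (sites_eq)
open T3LevelShift (bondShift)
open T3SectALandauChart (bgUnits eta eta_pos)
open Summit.QuantumFields.YangMills.Theorems.Prop7SectET3HilbertLetters (toL2 toL2S toL2B QL2 DL2 QL2_toL2)
open Summit.QuantumFields.YangMills.Theorems.Prop7SectET3GaugeProjector (NS mem_NS_iff)
open Summit.QuantumFields.YangMills.Theorems.Prop7SymAvgTwSym (QTwS logChartTwS differentiableAt_logChartTwS_of_regPr)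
open Summit.QuantumFields.YangMills.Theorems.Prop7SymAvgTwSGaugeDir (QTwS_gaugeDir_of_avgSeq)
open Summit.QuantumFields.YangMills.Theorems.Prop7NestedMeanParallelLift (toL2_symm_DL2_toL2S_eq topMean_parallel_of_mem_NS)

variable (F : T3Family) {n K : ℕ}

/-- ★★★ **A `Ū₀`-PARALLEL TOP MEAN PUTS THE PARAMETER IN `N_S(U₀)`**: for `U₀ ∈ 𝔘_k(ε₀)` (`RegPr`, `10¹²L³ε₀ ≤ 1`) and ANY averaging sequence `ns` of `λ` (`h0`, `hsucc` as in
✓`QTwS_gaugeDir_of_avgSeq`), if `Ad_{Ū₀(e)} ns_{K−n}(e₊) = ns_{K−n}(e₋)` on every coarse bond `e` (`Ū₀ = emlIterU (K − n) U₀♭`), then `toL2S λ ∈ N_S(U₀) = ker(Q(U₀)∘D_{U₀})`: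
(3.19) in closed form gives `Q(U₀)(D_{U₀}λ) = −η⁻¹·D_{Ū₀}(ns_{K−n}λ) = 0`. [cite: Balaban1985BackgroundPropagators, (3.19) p.393, (3.21) p.394, (3.115) p.418] -/
theorem mem_NS_of_topMean_parallel (h : n ≤ K) {c₀ : ℝ} [Fact (0 < c₀)] (cB : ℝ) {ε₀ : ℝ} (hε₀ : 0 < ε₀) (hWε : 10 ^ 12 * (F.L : ℝ) ^ 3 * ε₀ ≤ 1)
    (U₀ : GaugeField (F.P K) 0 (Matrix.specialUnitaryGroup (Fin 2) ℂ)) (hreg : RegPr F n K ε₀ U₀)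
    (ns : (j : ℕ) → Site (F.P K) j → Matrix (Fin 2) (Fin 2) ℂ) (l : Site (F.P K) 0 → Matrix (Fin 2) (Fin 2) ℂ) (h0 : ns 0 = l)
    (hsucc : ∀ (j : ℕ) (y : Site (F.P K) (j + 1)), ns (j + 1) y = ns j (emb y) - meanCLM (Idx (F.P K)) (Matrix (Fin 2) (Fin 2) ℂ) fun i : Idx (F.P K) =>
        ns j (emb y) - ((holT (emlIterU j (bgUnits F K U₀)) (emb y) (stairWord i.2.1 (off i.1)) : (Matrix (Fin 2) (Fin 2) ℂ)ˣ) : Matrix (Fin 2) (Fin 2) ℂ) *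
          ns j (transl (emb y) (disp (stairWord i.2.1 (off i.1)))) * (((holT (emlIterU j (bgUnits F K U₀)) (emb y) (stairWord i.2.1 (off i.1)))⁻¹ : (Matrix (Fin 2) (Fin 2) ℂ)ˣ) : Matrix (Fin 2) (Fin 2) ℂ))
    (hpar : ∀ e : PBond (F.P K) (K - n), conjR (emlIterU (K - n) (bgUnits F K U₀) e) (ns (K - n) e.tgt) = ns (K - n) e.src) :
    toL2S F K c₀ l ∈ NS F n K h c₀ cB U₀ := by
  have hS := differentiableAt_logChartTwS_of_regPr F h hε₀ hWε U₀ hreg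
  have hQ := QTwS_gaugeDir_of_avgSeq F h U₀ hS l ns h0 hsucc
  -- the right-hand side of (3.19) vanishes: the top mean is parallel
  have hzero : QTwS F n K h U₀ (fun b : PBond (F.P K) 0 => l b.src - ((bgUnits F K U₀ b : (Matrix (Fin 2) (Fin 2) ℂ)ˣ) : Matrix (Fin 2) (Fin 2) ℂ) * l b.tgt *
      (((bgUnits F K U₀ b)⁻¹ : (Matrix (Fin 2) (Fin 2) ℂ)ˣ) : Matrix (Fin 2) (Fin 2) ℂ)) = 0 := by
    rw [hQ]
    funext c
    have he := hpar (bondShift (sites_eq F n K h) c)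
    rw [conjR_apply] at he
    exact sub_eq_zero.2 he.symm
  -- the gauge direction of `λ` is `−η•G`, `G` the (3.3) stencil of `toL2S λ`
  set G : PBond (F.P K) 0 → Matrix (Fin 2) (Fin 2) ℂ := (toL2 F K c₀).symm (DL2 F n K c₀ U₀ (toL2S F K c₀ l)) with hGdef
  have hη : ((eta F n K : ℝ) : ℂ) ≠ 0 := by exact_mod_cast (eta_pos F n K).ne'
  have hdir : (fun b : PBond (F.P K) 0 => l b.src - ((bgUnits F K U₀ b : (Matrix (Fin 2) (Fin 2) ℂ)ˣ) : Matrix (Fin 2) (Fin 2) ℂ) * l b.tgt *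
      (((bgUnits F K U₀ b)⁻¹ : (Matrix (Fin 2) (Fin 2) ℂ)ˣ) : Matrix (Fin 2) (Fin 2) ℂ)) = (-((eta F n K : ℝ) : ℂ)) • G := by
    rw [hGdef, toL2_symm_DL2_toL2S_eq]
    funext b
    simp only [Pi.smul_apply, smul_smul, neg_mul, mul_inv_cancel₀ hη, neg_smul, one_smul, neg_sub, conjR_apply]
  have hG0 : QTwS F n K h U₀ G = 0 := by
    rw [hdir, map_smul] at hzero
    have hη' : (-((eta F n K : ℝ) : ℂ)) ≠ 0 := neg_ne_zero.2 hη
    exact (smul_eq_zero.1 hzero).resolve_left hη'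
  -- read back on `L²`
  rw [mem_NS_iff]
  have h2 : DL2 F n K c₀ U₀ (toL2S F K c₀ l) = toL2 F K c₀ G := by rw [hGdef, LinearEquiv.apply_symm_apply]
  rw [h2, QL2_toL2, hG0, map_zero]

/-- ★★ **PRINT'S `N(Q′) ⊆ N_S(U₀)`**: a parameter whose top nested mean VANISHES, `ns_{K−n} λ = 0`, lies in `N_S(U₀)` ((3.115) «the averages QA are invariant with respect to gauge
transformations λ ∈ N(Q′)»). [cite: Balaban1985BackgroundPropagators, (3.115) p.418, (3.21) p.394] -/
theorem mem_NS_of_topMean_eq_zero (h : n ≤ K) {c₀ : ℝ} [Fact (0 < c₀)] (cB : ℝ) {ε₀ : ℝ} (hε₀ : 0 < ε₀) (hWε : 10 ^ 12 * (F.L : ℝ) ^ 3 * ε₀ ≤ 1)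
    (U₀ : GaugeField (F.P K) 0 (Matrix.specialUnitaryGroup (Fin 2) ℂ)) (hreg : RegPr F n K ε₀ U₀)
    (ns : (j : ℕ) → Site (F.P K) j → Matrix (Fin 2) (Fin 2) ℂ) (l : Site (F.P K) 0 → Matrix (Fin 2) (Fin 2) ℂ) (h0 : ns 0 = l)
    (hsucc : ∀ (j : ℕ) (y : Site (F.P K) (j + 1)), ns (j + 1) y = ns j (emb y) - meanCLM (Idx (F.P K)) (Matrix (Fin 2) (Fin 2) ℂ) fun i : Idx (F.P K) =>
        ns j (emb y) - ((holT (emlIterU j (bgUnits F K U₀)) (emb y) (stairWord i.2.1 (off i.1)) : (Matrix (Fin 2) (Fin 2) ℂ)ˣ) : Matrix (Fin 2) (Fin 2) ℂ) *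
          ns j (transl (emb y) (disp (stairWord i.2.1 (off i.1)))) * (((holT (emlIterU j (bgUnits F K U₀)) (emb y) (stairWord i.2.1 (off i.1)))⁻¹ : (Matrix (Fin 2) (Fin 2) ℂ)ˣ) : Matrix (Fin 2) (Fin 2) ℂ))
    (htop : ∀ y : Site (F.P K) (K - n), ns (K - n) y = 0) :
    toL2S F K c₀ l ∈ NS F n K h c₀ cB U₀ :=
  mem_NS_of_topMean_parallel F h cB hε₀ hWε U₀ hreg ns l h0 hsucc fun e => by rw [htop, htop, conjR_apply, mul_zero, zero_mul]

/-- ★★★ **THE CHARACTERISATION OF THE RESIDUAL GAUGE ALGEBRA AT A PRINTED-REGULAR BACKGROUND**: `toL2S λ ∈ N_S(U₀)` iff the top nested covariant mean of `λ` (any averaging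
sequence) is `Ū₀`-parallel — (3.19)∕(3.115) read as «`ker(Q∘D_{U₀})` = parameters with coarse-covariantly-constant average». [cite: Balaban1985BackgroundPropagators, (3.19) p.393, (3.21) p.394, (3.115) p.418] -/
theorem mem_NS_iff_topMean_parallel (h : n ≤ K) {c₀ : ℝ} [Fact (0 < c₀)] (cB : ℝ) {ε₀ : ℝ} (hε₀ : 0 < ε₀) (hWε : 10 ^ 12 * (F.L : ℝ) ^ 3 * ε₀ ≤ 1)
    (U₀ : GaugeField (F.P K) 0 (Matrix.specialUnitaryGroup (Fin 2) ℂ)) (hreg : RegPr F n K ε₀ U₀)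
    (ns : (j : ℕ) → Site (F.P K) j → Matrix (Fin 2) (Fin 2) ℂ) (l : Site (F.P K) 0 → Matrix (Fin 2) (Fin 2) ℂ) (h0 : ns 0 = l)
    (hsucc : ∀ (j : ℕ) (y : Site (F.P K) (j + 1)), ns (j + 1) y = ns j (emb y) - meanCLM (Idx (F.P K)) (Matrix (Fin 2) (Fin 2) ℂ) fun i : Idx (F.P K) =>
        ns j (emb y) - ((holT (emlIterU j (bgUnits F K U₀)) (emb y) (stairWord i.2.1 (off i.1)) : (Matrix (Fin 2) (Fin 2) ℂ)ˣ) : Matrix (Fin 2) (Fin 2) ℂ) *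
          ns j (transl (emb y) (disp (stairWord i.2.1 (off i.1)))) * (((holT (emlIterU j (bgUnits F K U₀)) (emb y) (stairWord i.2.1 (off i.1)))⁻¹ : (Matrix (Fin 2) (Fin 2) ℂ)ˣ) : Matrix (Fin 2) (Fin 2) ℂ)) :
    toL2S F K c₀ l ∈ NS F n K h c₀ cB U₀ ↔
      ∀ e : PBond (F.P K) (K - n), conjR (emlIterU (K - n) (bgUnits F K U₀) e) (ns (K - n) e.tgt) = ns (K - n) e.src :=
  ⟨fun hl e => topMean_parallel_of_mem_NS F h hε₀ hWε U₀ hreg ns l h0 hsucc hl e, mem_NS_of_topMean_parallel F h cB hε₀ hWε U₀ hreg ns l h0 hsucc⟩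

end Summit.QuantumFields.YangMills.Theorems.Prop7NSOfParallelTopMean

end
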